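import Literature.NumberTheory.LFunctions.PartialEulerProductsLemma31Proofs
import Literature.NumberTheory.LFunctions.PartialEulerProductsAbelian
import Literature.NumberTheory.LFunctions.PartialEulerProductsConvergence
import Literature.NumberTheory.LFunctions.PartialEulerProductsPrimeLogSum
import Literature.NumberTheory.LFunctions.MertensConstant
import Mathlib.Analysis.Calculus.IteratedDeriv.Lemmas
import Mathlib.Analysis.Complex.RealDeriv
import HarnessLib

/-!
# Partial Euler products: Conrad's Theorem 5.3 as printed (single-sum hypothesis,
# constant `e^{C'} e^{rγ}`) — discharge of `Conrad2005_thm_5_3`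

Sibling proof file of `Literature.NumberTheory.LFunctions.PartialEulerProducts` discharging the
named fact `Literature.NumberTheory.LFunctions.PartialEuler.Conrad2005_thm_5_3` (K. Conrad, *Partial Euler products on the
critical line*, Canad. J. Math. **57** (2005), Thm. 5.3, p. 279): `Conrad2005_thm_5_3_holds`.
Under the printed hypothesis (5.1)
`∑_{p^k ≤ x} (α_{p,1}^k + ⋯ + α_{p,d}^k)/(k p^{k/2}) = -r log log x + C' + o(1)` (`r, C' ∈ ℂ`),
`L(s)` extends to a holomorphic nonvanishing `G` on `Re s > 1/2`, equal to the Euler product on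
`Re s > 1`, with `G(σ) ∼ e^{C'} e^{rγ} (σ - 1/2)^r` as `σ → 1/2⁺` (`Conrad2005_thm_5_3_main`, which
also records that the partial Euler products tend to `G` on `Re s > 1/2`); and if some `H`
holomorphic at `1/2` agrees with `G` immediately to the right of `1/2`, then the order of vanishing
of `H` at `1/2` is a natural number `m = r` and `H^{(m)}(1/2)/m! = e^{C'} e^{rγ}`
(`order_eq_of_analyticAt_of_eventuallyEq_exp`: writing `H(z) = (z - 1/2)^m g(z)` near `1/2`,
`u^{m-r} = e^{F(1/2+u) - r log u}/g(1/2+u)` has the nonzero limit `e^{C'+rγ}/g(1/2)` at `0⁺`, which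
forces `m = r` — shifting `t = log u` by `c` shows `e^{(m-r)c} = 1` for all real `c` — and then
`g(1/2) = e^{C'+rγ}`, while `H^{(m)}(1/2) = m! g(1/2)` by the Leibniz rule).

Proof (Conrad's, with the integral Abel summation replaced by the discrete one of this library
and `log log x` by Mertens' `A(x) = ∑_{p ≤ x} -log(1 - 1/p) = log log x + γ + o(1)`): put
`c_n = b_n n^{-1/2}` (`b_n` the coefficients of `log L`, `logCoeff`), `m_n = -log(1 - 1/n)` at primes,
`a_n = c_n + r m_n`. By (5.1) and `Literature.NumberTheory.LFunctions.Mertens.tendsto_mertensLog_sub_loglog` the partial sums of `a`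
converge to `C' + rγ`, so `∑ a_n n^{-w}` converges locally uniformly on `Re w > 0` (Abel summation,
`…Summation`) and tends to `C' + rγ` as `w = u → 0⁺` (`…Abelian`); `∑ m_n n^{-w}` converges absolutely,
and `∑_p m_p p^{-u} = -log u + o(1)` (`…PrimeLogSum`). Hence `F(s) = lim_N ∑_{n ≤ N} b_n n^{-s}` is
holomorphic on `Re s > 1/2` with `F(1/2 + u) = r log u + C' + rγ + o(1)`; by Lemma 3.1 (proved,
`…Lemma31Proofs`) the double sums `∑_{p ≤ x} ∑_j -log(1 - α_{p,j} p^{-s})` have the same limit, so the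
partial Euler products tend to `G = exp F`, which is the Euler product on `Re s > 1`
(`…Convergence`), and `G(1/2+u)/(e^{C'} e^{rγ} u^r) = exp(o(1)) → 1`. No definitions are introduced.

## References

* K. Conrad, *Partial Euler products on the critical line*, Canad. J. Math. 57 (2005) 267–297,
  Thm. 5.3 and its proof, Lemmas 5.1–5.2. [cite: Conrad2005PartialEuler]
-/

noncomputable section

open scoped Topology
open Filter Finset Complex Metric Asymptotics Literature.NumberTheory.LFunctions.Nicolas

namespace Literature.NumberTheory.LFunctions

namespace PartialEuler

variable {d : ℕ} {α : ℕ → Fin d → ℂ}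

/-! ### The coefficients `c_n = b_n n^{-1/2}`, `m_n`, `a_n = c_n + r m_n` and their partial sums -/

/-- The single sum at a natural number with the weight split off:
`∑_{n ≤ N} b_n n^{-s} = ∑_{n < N+1} n^{-(s-1/2)} (b_n n^{-1/2})`. [folklore] -/
theorem logPartialSum_natCast_eq_sum_range_cpow (α : ℕ → Fin d → ℂ) (s : ℂ) (N : ℕ) :
    logPartialSum α s N = ∑ n ∈ Finset.range (N + 1),
      (n : ℂ) ^ (-(s - 1 / 2)) * (logCoeff α n * (n : ℂ) ^ (-(1 / 2 : ℂ))) := by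
  rw [logPartialSum, Nat.floor_natCast]
  have hIic : Finset.Iic N = Finset.range (N + 1) := by ext n; simp
  rw [hIic]
  refine Finset.sum_congr rfl fun n _ => ?_
  rcases Nat.eq_zero_or_pos n with rfl | hn
  · have h0 : logCoeff α 0 = 0 := logCoeff_of_not_isPrimePow α not_isPrimePow_zero
    simp [h0]
  · rw [natCast_cpow_neg_eq_half_mul hn.ne' s]
    ring

/-- The partial sums of `m_n = -log(1 - 1/n)` (primes): `∑_{n < N+1} m_n = A(N)`
(`Literature.NumberTheory.LFunctions.Nicolas.mertensLog`). [folklore] -/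
theorem sum_range_succ_primeLogCoeff (N : ℕ) :
    ∑ n ∈ Finset.range (N + 1), (primeLogCoeff n : ℂ) = (mertensLog N : ℂ) := by
  rw [mertensLog, Nat.floor_natCast, ofReal_sum, Finset.range_eq_Ico,
    show Finset.Ico 0 (N + 1) = Finset.Icc 0 N from rfl, Finset.Icc_eq_cons_Ioc (Nat.zero_le N),
    Finset.sum_cons]
  simp only [primeLogCoeff_zero, ofReal_zero, zero_add]
  rfl

/-- **The partial sums of `a_n = b_n n^{-1/2} + r m_n` converge to `C' + rγ`** under (5.1), by
Mertens' `A(x) - log log x → γ`. [cite: Conrad2005PartialEuler, proof of Thm. 5.3] -/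
theorem tendsto_sum_range_aCoeff (α : ℕ → Fin d → ℂ) {r C' : ℂ}
    (hH : Tendsto (fun x : ℝ => logPartialSum α (1 / 2) x -
      (-r * log ((Real.log x : ℝ) : ℂ) + C')) atTop (𝓝 0)) :
    Tendsto (fun N : ℕ => ∑ n ∈ Finset.range N,
      (logCoeff α n * (n : ℂ) ^ (-(1 / 2 : ℂ)) + r * (primeLogCoeff n : ℂ))) atTop
      (𝓝 (C' + r * (Real.eulerMascheroniConstant : ℂ))) := by
  -- along `N + 1`
  have hM := (Literature.NumberTheory.LFunctions.Mertens.tendsto_mertensLog_sub_loglog.comp tendsto_natCast_atTop_atTop)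
  have hH' := hH.comp tendsto_natCast_atTop_atTop
  have key : Tendsto (fun N : ℕ => ∑ n ∈ Finset.range (N + 1),
      (logCoeff α n * (n : ℂ) ^ (-(1 / 2 : ℂ)) + r * (primeLogCoeff n : ℂ))) atTop
      (𝓝 (C' + r * (Real.eulerMascheroniConstant : ℂ))) := by
    have h1 : Tendsto (fun N : ℕ => (logPartialSum α (1 / 2) N - (-r * log ((Real.log N : ℝ) : ℂ) + C')) +
        C' + r * (((mertensLog N - Real.log (Real.log N) : ℝ)) : ℂ)) atTop
        (𝓝 (0 + C' + r * (Real.eulerMascheroniConstant : ℂ))) := by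
      refine (hH'.add tendsto_const_nhds).add ?_
      exact ((continuous_ofReal.tendsto _).comp hM).const_mul r
    rw [zero_add] at h1
    refine h1.congr' ?_
    filter_upwards [eventually_gt_atTop 1] with N hN
    have hN1 : (1 : ℝ) < N := by exact_mod_cast hN
    have hlog : 0 < Real.log N := Real.log_pos hN1
    rw [Finset.sum_add_distrib, ← Finset.mul_sum,
      sum_range_succ_primeLogCoeff,
      logPartialSum_natCast_eq_sum_range_cpow]
    have hw : ∀ n ∈ Finset.range (N + 1), (n : ℂ) ^ (-((1 / 2 : ℂ) - 1 / 2)) *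
        (logCoeff α n * (n : ℂ) ^ (-(1 / 2 : ℂ))) = logCoeff α n * (n : ℂ) ^ (-(1 / 2 : ℂ)) := by
      intro n _
      rw [sub_self, neg_zero, cpow_zero, one_mul]
    rw [Finset.sum_congr rfl hw, ← ofReal_log hlog.le]
    push_cast
    ring
  -- shift back
  rw [← tendsto_add_atTop_iff_nat 1]
  exact key

/-- `|m_n| ≤ 2/n` (complex norm). [folklore] -/
theorem norm_primeLogCoeff_le (n : ℕ) : ‖(primeLogCoeff n : ℂ)‖ ≤ 2 / n := by
  rw [norm_real, Real.norm_eq_abs]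
  exact abs_primeLogCoeff_le n

/-! ### The limit function on `Re s > 1/2` -/

/-- **The logarithm of `L(s)` on `Re s > 1/2` under (5.1), and its behaviour at `1/2⁺`.** Under
Conrad's hypothesis (5.1) there is `F : ℂ → ℂ`, holomorphic on `Re s > 1/2`, such that the single
sums `s ↦ ∑_{n ≤ N} b_n n^{-s}` converge to `F` locally uniformly on `Re s > 1/2`, the double sums
`∑_{p ≤ x} ∑_j -log(1 - α_{p,j} p^{-s})` converge to `F(s)` for each such `s` (Lemma 3.1), and
`F(1/2 + u) - r log u → C' + rγ` as `u → 0⁺`. [cite: Conrad2005PartialEuler, proof of Thm. 5.3] -/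
theorem exists_logLimit_of_single_sum (hα : IsNormalized α) {r C' : ℂ}
    (hH : Tendsto (fun x : ℝ => logPartialSum α (1 / 2) x -
      (-r * log ((Real.log x : ℝ) : ℂ) + C')) atTop (𝓝 0)) :
    ∃ F : ℂ → ℂ, DifferentiableOn ℂ F {s : ℂ | 1 / 2 < s.re} ∧
      TendstoLocallyUniformlyOn (fun (N : ℕ) (s : ℂ) => logPartialSum α s N) F atTop
        {s : ℂ | 1 / 2 < s.re} ∧
      (∀ s : ℂ, 1 / 2 < s.re → Tendsto (fun x : ℝ => logPartialProduct α s x) atTop (𝓝 (F s))) ∧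
      Tendsto (fun u : ℝ => F (1 / 2 + u) - r * Real.log u) (𝓝[>] 0)
        (𝓝 (C' + r * (Real.eulerMascheroniConstant : ℂ))) := by
  have hΩ : IsOpen {s : ℂ | 1 / 2 < s.re} := isOpen_lt continuous_const continuous_re
  -- the sequence `a` and its convergent (hence bounded) partial sums
  set a : ℕ → ℂ := fun n => logCoeff α n * (n : ℂ) ^ (-(1 / 2 : ℂ)) + r * (primeLogCoeff n : ℂ) with ha
  have hlc0 : logCoeff α 0 = 0 := logCoeff_of_not_isPrimePow α not_isPrimePow_zero
  have ha0 : a 0 = 0 := by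
    simp only [ha, hlc0, primeLogCoeff_zero, ofReal_zero, mul_zero, zero_mul, add_zero]
  have hA := tendsto_sum_range_aCoeff α hH
  obtain ⟨M, hM⟩ := (hA.norm).bddAbove_range
  have hAM : ∀ N, ‖∑ n ∈ Finset.range N, a n‖ ≤ M := fun N => hM ⟨N, rfl⟩
  -- the pieces of the limit: Abel sum of `a`, and the absolutely convergent `∑ r m_n n^{-w}`
  set T : ℂ → ℂ := fun w => -∑' i : ℕ,
    ((((i + 1 : ℕ) : ℂ) ^ (-w)) - (i : ℂ) ^ (-w)) * ∑ n ∈ Finset.range (i + 1), a n with hT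
  set P : ℂ → ℂ := fun s => ∑' n : ℕ, (n : ℂ) ^ (-(s - 1 / 2)) * (r * (primeLogCoeff n : ℂ)) with hP
  set F : ℂ → ℂ := fun s => T (s - 1 / 2) - P s with hF
  -- the single sum in terms of `a` and `r m`
  have hsingle : ∀ (N : ℕ) (s : ℂ), logPartialSum α s N =
      ∑ n ∈ Finset.range (N + 1), (n : ℂ) ^ (-(s - 1 / 2)) * a n -
        ∑ n ∈ Finset.range (N + 1), (n : ℂ) ^ (-(s - 1 / 2)) * (r * (primeLogCoeff n : ℂ)) := by
    intro N s
    rw [logPartialSum_natCast_eq_sum_range_cpow, ← Finset.sum_sub_distrib]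
    refine Finset.sum_congr rfl fun n _ => ?_
    simp only [ha]
    ring
  -- Step 1: uniform convergence of the single sums on half-strips
  have hstrip : ∀ {δ : ℝ}, 0 < δ → ∀ R : ℝ,
      TendstoUniformlyOn (fun (N : ℕ) (s : ℂ) => logPartialSum α s N) F atTop
        {s : ℂ | δ ≤ (s - 1 / 2).re ∧ ‖s - 1 / 2‖ ≤ R} := by
    intro δ hδ R
    set S : Set ℂ := {s : ℂ | δ ≤ (s - 1 / 2).re ∧ ‖s - 1 / 2‖ ≤ R} with hS
    -- (a) the `a`-part, by Abel summation composed with `s ↦ s - 1/2`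
    have h1 : TendstoUniformlyOn (fun (N : ℕ) (s : ℂ) => ∑ n ∈ Finset.range N,
        (n : ℂ) ^ (-(s - 1 / 2)) * a n) (fun s => T (s - 1 / 2)) atTop S :=
      (tendstoUniformlyOn_sum_range_cpow_mul hAM hδ R).comp (fun s : ℂ => s - 1 / 2)
    -- (b) the `r m`-part, M-test with `‖n^{-w} r m_n‖ ≤ 2 ‖r‖ n^{-1-δ}`
    have h2 : TendstoUniformlyOn (fun (N : ℕ) (s : ℂ) => ∑ n ∈ Finset.range N,
        (n : ℂ) ^ (-(s - 1 / 2)) * (r * (primeLogCoeff n : ℂ))) P atTop S := by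
      refine tendstoUniformlyOn_tsum_nat (u := fun n : ℕ => 2 * ‖r‖ * (n : ℝ) ^ (-1 - δ))
        ((Real.summable_nat_rpow.mpr (by linarith)).mul_left (2 * ‖r‖)) fun n s hs => ?_
      rcases Nat.eq_zero_or_pos n with rfl | hn
      · simp [primeLogCoeff_zero, Real.zero_rpow (by linarith : (-1 - δ : ℝ) ≠ 0)]
      · rw [norm_mul, norm_mul, norm_natCast_cpow_of_pos hn]
        have hre : (-(s - 1 / 2)).re ≤ -δ := by
          have := hs.1; simp only [neg_re] at this ⊢; linarith
        have hn1 : (1 : ℝ) ≤ n := by exact_mod_cast hn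
        calc (n : ℝ) ^ (-(s - 1 / 2)).re * (‖r‖ * ‖(primeLogCoeff n : ℂ)‖) ≤
            (n : ℝ) ^ (-δ) * (‖r‖ * (2 / n)) := by
              refine mul_le_mul (Real.rpow_le_rpow_of_exponent_le hn1 hre) ?_ (by positivity)
                (by positivity)
              exact mul_le_mul_of_nonneg_left (norm_primeLogCoeff_le n) (norm_nonneg r)
          _ = 2 * ‖r‖ * (n : ℝ) ^ (-1 - δ) := by
              rw [show (-1 - δ : ℝ) = -δ + (-1) by ring, Real.rpow_add (by positivity),
                Real.rpow_neg_one]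
              ring
    have h12 := tendstoUniformlyOn_comp_index (h1.sub h2) (tendsto_add_atTop_nat 1)
    refine h12.congr (Eventually.of_forall fun N s _ => ?_)
    simp only [Pi.sub_apply]
    exact (hsingle N s).symm
  -- Step 2: locally uniform convergence and holomorphy
  have hloc : TendstoLocallyUniformlyOn (fun (N : ℕ) (s : ℂ) => logPartialSum α s N) F atTop
      {s : ℂ | 1 / 2 < s.re} := by
    rw [tendstoLocallyUniformlyOn_iff_forall_isCompact hΩ]
    intro K hKΩ hK
    obtain ⟨δ, R, hδ, hKS⟩ := exists_strip_of_isCompact hK hKΩ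
    exact (hstrip hδ R).mono hKS
  have hdiffN : ∀ N : ℕ, DifferentiableOn ℂ (fun s : ℂ => logPartialSum α s N) {s : ℂ | 1 / 2 < s.re} := by
    intro N
    refine DifferentiableOn.fun_sum fun n _ => ?_
    rcases Nat.eq_zero_or_pos n with rfl | hn
    · have : (fun s : ℂ => logCoeff α 0 * (((0 : ℕ) : ℂ)) ^ (-s)) = fun _ => 0 := by
        funext s; rw [hlc0, zero_mul]
      rw [this]
      exact differentiableOn_const 0
    · refine DifferentiableOn.const_mul ?_ _
      intro s _
      exact (differentiableAt_id.neg.const_cpow (Or.inl (Nat.cast_ne_zero.mpr hn.ne'))).differentiableWithinAt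
  have hdiff : DifferentiableOn ℂ F {s : ℂ | 1 / 2 < s.re} :=
    hloc.differentiableOn (Eventually.of_forall hdiffN) hΩ
  -- Step 3: the double sums have the same limit (Lemma 3.1)
  have hpt : ∀ s : ℂ, 1 / 2 < s.re → Tendsto (fun x : ℝ => logPartialProduct α s x) atTop (𝓝 (F s)) := by
    intro s hs
    have hS : Tendsto (fun x : ℝ => logPartialSum α s x) atTop (𝓝 (F s)) := by
      have h := (hloc.tendsto_at hs).comp (tendsto_nat_floor_atTop (α := ℝ))
      refine h.congr fun x => ?_
      simp only [Function.comp_apply, logPartialSum, Nat.floor_natCast]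
    obtain ⟨h31a, h31b⟩ := Conrad2005_lemma_3_1_holds d α hα s hs.le
    have hM := h31b hs
    have hDS : Tendsto (fun x : ℝ => logPartialProduct α s x - logPartialSum α s x) atTop (𝓝 0) := by
      have := h31a.add hM
      rw [zero_add] at this
      exact this.congr fun x => by ring
    have := hDS.add hS
    rw [zero_add] at this
    exact this.congr fun x => by ring
  -- Step 4: the behaviour at `1/2 + u`
  have hbd : Tendsto (fun u : ℝ => F (1 / 2 + u) - r * Real.log u) (𝓝[>] 0)
      (𝓝 (C' + r * (Real.eulerMascheroniConstant : ℂ))) := by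
    -- (a) the Abel part
    have hTlim : Tendsto (fun u : ℝ => T ((1 / 2 + u) - 1 / 2)) (𝓝[>] 0)
        (𝓝 (C' + r * (Real.eulerMascheroniConstant : ℂ))) := by
      have h := tendsto_abelSum_nhdsGT_zero ha0 hA
      refine h.congr fun u => ?_
      simp only [hT]
      rw [show (1 / 2 : ℂ) + u - 1 / 2 = (u : ℂ) by ring]
    -- (b) the `m` part: `P (1/2+u) = r ∑_p m_p p^{-u}` and `∑_p m_p p^{-u} + log u → 0`
    have hPlim : Tendsto (fun u : ℝ => P (1 / 2 + u) + r * Real.log u) (𝓝[>] 0) (𝓝 0) := by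
      have key := tendsto_tsum_neg_log_one_sub_inv_mul_rpow_add_log
      have h := ((continuous_ofReal.tendsto _).comp key).const_mul r
      simp only [ofReal_zero, mul_zero] at h
      refine h.congr' ?_
      filter_upwards [self_mem_nhdsWithin] with u hu
      have hu0 : 0 < u := hu
      simp only [Function.comp_apply, hP]
      -- the `ℕ`-indexed series as a series over the primes
      have hPu : ∑' n : ℕ, (n : ℂ) ^ (-(((1 / 2 : ℂ) + u) - 1 / 2)) * (r * (primeLogCoeff n : ℂ)) =
          r * ((∑' p : Nat.Primes, (-Real.log (1 - ((p : ℕ) : ℝ)⁻¹)) * ((p : ℕ) : ℝ) ^ (-u) : ℝ) : ℂ) := by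
        have hterm : ∀ n : ℕ, (n : ℂ) ^ (-(((1 / 2 : ℂ) + u) - 1 / 2)) * (r * (primeLogCoeff n : ℂ)) =
            (if n.Prime then r * (((-Real.log (1 - (n : ℝ)⁻¹)) * (n : ℝ) ^ (-u) : ℝ) : ℂ) else 0) := by
          intro n
          rw [show -(((1 / 2 : ℂ) + u) - 1 / 2) = -(u : ℂ) by ring, natCast_cpow_neg_ofReal]
          by_cases hn : n.Prime
          · rw [if_pos hn, primeLogCoeff_of_prime hn]
            push_cast
            ring
          · rw [if_neg hn, primeLogCoeff_of_not_prime hn]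
            simp
        rw [tsum_congr hterm]
        have hsum : Summable fun p : Nat.Primes =>
            (-Real.log (1 - ((p : ℕ) : ℝ)⁻¹)) * ((p : ℕ) : ℝ) ^ (-u) := by
          refine Summable.of_norm_bounded (g := fun p : Nat.Primes => 2 * ((p : ℕ) : ℝ) ^ (-(1 + u)))
            ((Nat.Primes.summable_rpow.mpr (by linarith)).mul_left 2) fun p => ?_
          have hp0 : (0 : ℝ) < (p : ℕ) := by exact_mod_cast p.2.pos
          rw [Real.norm_eq_abs, abs_mul, abs_of_nonneg (by positivity : (0 : ℝ) ≤ ((p : ℕ) : ℝ) ^ (-u)),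
            ← primeLogCoeff_of_prime p.2]
          calc |primeLogCoeff p| * ((p : ℕ) : ℝ) ^ (-u) ≤ 2 / ((p : ℕ) : ℝ) * ((p : ℕ) : ℝ) ^ (-u) :=
                mul_le_mul_of_nonneg_right (abs_primeLogCoeff_le p) (by positivity)
            _ = 2 * ((p : ℕ) : ℝ) ^ (-(1 + u)) := by
                rw [neg_add, Real.rpow_add hp0, Real.rpow_neg_one, div_eq_mul_inv]
                ring
        have hhs : HasSum (fun p : Nat.Primes => r * (((-Real.log (1 - ((p : ℕ) : ℝ)⁻¹)) *
            ((p : ℕ) : ℝ) ^ (-u) : ℝ) : ℂ)) (r * ((∑' p : Nat.Primes,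
              (-Real.log (1 - ((p : ℕ) : ℝ)⁻¹)) * ((p : ℕ) : ℝ) ^ (-u) : ℝ) : ℂ)) := by
          exact ((hasSum_ofReal.mpr hsum.hasSum).mul_left r)
        exact (hasSum_ite_prime_iff.mpr hhs).tsum_eq
      rw [hPu]
      push_cast
      ring
    have := hTlim.sub hPlim
    rw [sub_zero] at this
    refine this.congr fun u => ?_
    simp only [hF]
    ring
  exact ⟨F, hdiff, hloc, hpt, hbd⟩

/-! ### Holomorphy at `1/2` forces `r ∈ ℕ` (the fifth conclusion, abstractly) -/

/-- If `exp (z t) → L ≠ 0` as the real variable `t → -∞`, then `z = 0`: shifting `t` by `c`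
multiplies the limit by `exp (z c)`, so `exp (z c) = 1` for all real `c`; differentiate at
`c = 0`. [folklore] -/
theorem eq_zero_of_tendsto_exp_mul_atBot {z L : ℂ} (hL : L ≠ 0)
    (h : Tendsto (fun t : ℝ => exp (z * t)) atBot (𝓝 L)) : z = 0 := by
  -- `exp (z c) = 1` for every real `c`
  have hc : ∀ c : ℝ, exp (z * c) = 1 := by
    intro c
    have h1 : Tendsto (fun t : ℝ => exp (z * ((t + c : ℝ) : ℂ))) atBot (𝓝 L) :=
      h.comp (tendsto_atBot_add_const_right _ c tendsto_id)
    have h2 : Tendsto (fun t : ℝ => exp (z * ((t + c : ℝ) : ℂ))) atBot (𝓝 (exp (z * c) * L)) := by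
      refine (h.const_mul (exp (z * c))).congr fun t => ?_
      rw [← exp_add]
      push_cast
      ring_nf
    have h3 := tendsto_nhds_unique h1 h2
    have h4 : (exp (z * c) - 1) * L = 0 := by rw [sub_mul, one_mul, ← h3, sub_self]
    rcases mul_eq_zero.mp h4 with h5 | h5
    · exact sub_eq_zero.mp h5
    · exact absurd h5 hL
  -- differentiate `c ↦ exp (z c) = 1` at `c = 0`
  have hd : HasDerivAt (fun c : ℝ => exp (z * (c : ℂ))) z 0 := by
    have : HasDerivAt (fun w : ℂ => exp (z * w)) (exp (z * ((0 : ℝ) : ℂ)) * (z * 1))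
        ((0 : ℝ) : ℂ) := ((hasDerivAt_id _).const_mul z).cexp
    simp only [ofReal_zero, mul_zero, exp_zero, one_mul, mul_one] at this
    exact this.comp_ofReal
  have hd0 : HasDerivAt (fun c : ℝ => exp (z * (c : ℂ))) 0 0 := by
    have : (fun c : ℝ => exp (z * (c : ℂ))) = fun _ => 1 := funext hc
    rw [this]
    exact hasDerivAt_const _ _
  exact hd.unique hd0

/-- If `exp (z log u) → L ≠ 0` as `u → 0⁺`, then `z = 0`. [folklore] -/
theorem eq_zero_of_tendsto_exp_mul_log {z L : ℂ} (hL : L ≠ 0)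
    (h : Tendsto (fun u : ℝ => exp (z * Real.log u)) (𝓝[>] 0) (𝓝 L)) : z = 0 := by
  refine eq_zero_of_tendsto_exp_mul_atBot hL ?_
  refine (h.comp Real.tendsto_exp_atBot_nhdsGT).congr fun t => ?_
  simp only [Function.comp_apply, Real.log_exp]

/-- **Leading Taylor coefficient from the local factorization.** If `H z = (z - z₀)^m • g z` near
`z₀` with `g` analytic at `z₀`, then `H^{(m)}(z₀) = m! · g(z₀)` (Leibniz rule). [folklore] -/
theorem iteratedDeriv_eq_factorial_mul_of_eventuallyEq {H g : ℂ → ℂ} {z₀ : ℂ} {m : ℕ}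
    (hg : AnalyticAt ℂ g z₀) (hH : ∀ᶠ z in 𝓝 z₀, H z = (z - z₀) ^ m • g z) :
    iteratedDeriv m H z₀ = m.factorial * g z₀ := by
  have h1 : iteratedDeriv m H z₀ = iteratedDeriv m (fun z => (z - z₀) ^ m * g z) z₀ :=
    Filter.EventuallyEq.iteratedDeriv_eq m (hH.mono fun z hz => by rw [hz, smul_eq_mul])
  rw [h1]
  have hf : ContDiffAt ℂ m (fun z => (z - z₀) ^ m) z₀ := (contDiffAt_id.sub contDiffAt_const).pow m
  have hgc : ContDiffAt ℂ m g z₀ := hg.contDiffAt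
  rw [iteratedDeriv_fun_mul hf hgc]
  -- the `i`-th derivative of `(z - z₀)^m` at `z₀` is `m!` if `i = m` and `0` otherwise
  have hpow : ∀ i : ℕ, iteratedDeriv i (fun z => (z - z₀) ^ m) z₀ =
      if i = m then (m.factorial : ℂ) else 0 := by
    intro i
    have := congrFun (iteratedDeriv_comp_sub_const (n := i) (f := fun z : ℂ => z ^ m) (s := z₀)) z₀
    simp only [sub_self] at this
    rw [this, iteratedDeriv_fun_pow_zero, Nat.cast_ite, Nat.cast_zero]
  rw [Finset.sum_eq_single m]
  · simp [hpow, Nat.choose_self, iteratedDeriv_zero]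
  · intro i _ him
    simp [hpow, him]
  · intro h
    exact absurd (Finset.self_mem_range_succ m) h

/-- **The fifth conclusion of Theorem 5.3, abstractly.** If `F(1/2 + u) - r log u → κ` as
`u → 0⁺` and `H` is analytic at `1/2` and agrees with `exp ∘ F` on a right half-neighbourhood of
`1/2` in `Re s > 1/2`, then the order of vanishing of `H` at `1/2` is a natural number `m` with
`m = r`, and `H^{(m)}(1/2)/m! = exp κ`: comparing `H(1/2 + u) = u^m g(1/2 + u)` with
`exp F(1/2 + u) = u^r e^{κ + o(1)}` forces `u^{m - r}` to have a nonzero limit at `0⁺`, whence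
`m = r` and `g(1/2) = e^κ`. [cite: Conrad2005PartialEuler, proof of Thm. 5.3] -/
theorem order_eq_of_analyticAt_of_eventuallyEq_exp {F H : ℂ → ℂ} {r κ : ℂ}
    (hF : Tendsto (fun u : ℝ => F (1 / 2 + u) - r * Real.log u) (𝓝[>] 0) (𝓝 κ))
    (hHa : AnalyticAt ℂ H (1 / 2 : ℂ))
    (hHG : ∀ᶠ s in 𝓝[{s : ℂ | 1 / 2 < s.re}] (1 / 2 : ℂ), H s = exp (F s)) :
    ∃ m : ℕ, (m : ℂ) = r ∧ analyticOrderAt H (1 / 2 : ℂ) = m ∧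
      iteratedDeriv m H (1 / 2 : ℂ) / (m.factorial : ℂ) = exp κ := by
  -- the path `u ↦ 1/2 + u`, `u → 0⁺`, inside `Re s > 1/2`
  have hpath : Tendsto (fun u : ℝ => (1 / 2 : ℂ) + u) (𝓝[>] 0)
      (𝓝[{s : ℂ | 1 / 2 < s.re}] (1 / 2 : ℂ)) := by
    refine tendsto_nhdsWithin_of_tendsto_nhds_of_eventually_within _ ?_ ?_
    · have : Tendsto (fun u : ℝ => (1 / 2 : ℂ) + u) (𝓝 0) (𝓝 ((1 / 2 : ℂ) + ((0 : ℝ) : ℂ))) :=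
        ((continuous_const.add continuous_ofReal).tendsto 0)
      rw [ofReal_zero, add_zero] at this
      exact this.mono_left nhdsWithin_le_nhds
    · filter_upwards [self_mem_nhdsWithin] with u hu
      have hu0 : (0 : ℝ) < u := hu
      show 1 / 2 < ((1 / 2 : ℂ) + (u : ℂ)).re
      rw [show (1 / 2 : ℂ) + (u : ℂ) = ((1 / 2 + u : ℝ) : ℂ) by push_cast; ring, ofReal_re]
      linarith
  have hpath' : Tendsto (fun u : ℝ => (1 / 2 : ℂ) + u) (𝓝[>] 0) (𝓝 (1 / 2 : ℂ)) :=
    hpath.mono_right nhdsWithin_le_nhds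
  have hHG' : ∀ᶠ u : ℝ in 𝓝[>] 0, H ((1 / 2 : ℂ) + u) = exp (F ((1 / 2 : ℂ) + u)) :=
    hpath.eventually hHG
  -- the order of `H` at `1/2` is finite, since `H = exp F ≠ 0` nearby on the right
  have hfin : analyticOrderAt H (1 / 2 : ℂ) ≠ ⊤ := by
    intro htop
    have h0 : ∀ᶠ u : ℝ in 𝓝[>] 0, H ((1 / 2 : ℂ) + u) = 0 :=
      hpath'.eventually (analyticOrderAt_eq_top.mp htop)
    obtain ⟨u, hu1, hu2⟩ := (hHG'.and h0).exists
    exact exp_ne_zero _ (hu1.symm.trans hu2)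
  obtain ⟨m, hm⟩ := ENat.ne_top_iff_exists.mp hfin
  obtain ⟨g, hga, hg0, hHg⟩ := (hHa.analyticOrderAt_eq_natCast).mp hm.symm
  have hHg' : ∀ᶠ u : ℝ in 𝓝[>] 0, H ((1 / 2 : ℂ) + u) = (u : ℂ) ^ m * g ((1 / 2 : ℂ) + u) := by
    filter_upwards [hpath'.eventually hHg] with u hu
    rw [hu, smul_eq_mul, add_sub_cancel_left]
  -- `g (1/2 + u) → g (1/2) ≠ 0`
  have hglim : Tendsto (fun u : ℝ => g ((1 / 2 : ℂ) + u)) (𝓝[>] 0) (𝓝 (g (1 / 2))) :=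
    hga.continuousAt.tendsto.comp hpath'
  -- growth comparison: `exp ((m - r) log u) = exp (F(1/2+u) - r log u) / g (1/2 + u) → exp κ / g (1/2)`
  have hkey : Tendsto (fun u : ℝ => exp (((m : ℂ) - r) * Real.log u)) (𝓝[>] 0)
      (𝓝 (exp κ / g (1 / 2))) := by
    have hlim : Tendsto (fun u : ℝ => exp (F (1 / 2 + u) - r * Real.log u) / g ((1 / 2 : ℂ) + u))
        (𝓝[>] 0) (𝓝 (exp κ / g (1 / 2))) :=
      ((continuous_exp.tendsto _).comp hF).div hglim hg0
    refine hlim.congr' ?_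
    filter_upwards [hHG', hHg', self_mem_nhdsWithin] with u h1 h2 hu
    have hu0 : (0 : ℝ) < u := hu
    have hum : (u : ℂ) ^ m = exp ((m : ℂ) * (Real.log u : ℂ)) := by
      have hr : (u : ℝ) ^ m = Real.exp (m * Real.log u) := by
        rw [← Real.rpow_natCast, Real.rpow_def_of_pos hu0, mul_comm]
      have : ((u : ℝ) : ℂ) ^ m = (((u ^ m : ℝ)) : ℂ) := by push_cast; rfl
      rw [this, hr, ofReal_exp]
      push_cast
      rfl
    have eq1 : exp (F (1 / 2 + u)) = (u : ℂ) ^ m * g (1 / 2 + u) := h1.symm.trans h2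
    have hg_ne : g (1 / 2 + (u : ℂ)) ≠ 0 := by
      intro h0
      rw [h0, mul_zero] at eq1
      exact exp_ne_zero _ eq1
    rw [div_eq_iff hg_ne, exp_sub, eq1, hum, sub_mul, exp_sub]
    field_simp
  -- hence `m = r`
  have hL : exp κ / g (1 / 2) ≠ 0 := div_ne_zero (exp_ne_zero _) hg0
  have hmr : (m : ℂ) - r = 0 := eq_zero_of_tendsto_exp_mul_log hL hkey
  have hmr' : (m : ℂ) = r := sub_eq_zero.mp hmr
  refine ⟨m, hmr', hm.symm, ?_⟩
  -- and `g (1/2) = exp κ`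
  have hg12 : g (1 / 2) = exp κ := by
    simp only [hmr, zero_mul, exp_zero] at hkey
    have h1 : exp κ / g (1 / 2) = 1 := tendsto_nhds_unique hkey tendsto_const_nhds
    exact ((div_eq_one_iff_eq hg0).mp h1).symm
  rw [iteratedDeriv_eq_factorial_mul_of_eventuallyEq hga hHg, hg12,
    mul_div_cancel_left₀ _ (Nat.cast_ne_zero.mpr (Nat.factorial_ne_zero m))]

/-! ### Theorem 5.3 -/

/-- For `u > 0` and complex `r`: `u^r = exp (r log u)` with the real logarithm. [folklore] -/
theorem ofReal_cpow_eq_exp {u : ℝ} (hu : 0 < u) (r : ℂ) : ((u : ℝ) : ℂ) ^ r = exp (r * Real.log u) := by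
  rw [cpow_def_of_ne_zero (by exact_mod_cast hu.ne'), ← ofReal_log hu.le, mul_comm]

/-- The conclusions of Theorem 5.3 for `G = exp ∘ F`, with `F` the logarithm of
`exists_logLimit_of_single_sum`: `G` is holomorphic and zero-free on `Re s > 1/2`, is the Euler
product on `Re s > 1`, satisfies (5.2) `G(σ) ∼ e^{C'} e^{rγ} (σ - 1/2)^r` (`σ → 1/2⁺`), and is the
limit of the partial Euler products on `Re s > 1/2`. [cite: Conrad2005PartialEuler, Thm. 5.3] -/
theorem thm_5_3_of_logLimit (hα : IsNormalized α) {r C' : ℂ} {F : ℂ → ℂ}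
    (hFd : DifferentiableOn ℂ F {s : ℂ | 1 / 2 < s.re})
    (hpt : ∀ s : ℂ, 1 / 2 < s.re → Tendsto (fun x : ℝ => logPartialProduct α s x) atTop (𝓝 (F s)))
    (hbd : Tendsto (fun u : ℝ => F (1 / 2 + u) - r * Real.log u) (𝓝[>] 0)
      (𝓝 (C' + r * (Real.eulerMascheroniConstant : ℂ)))) :
    DifferentiableOn ℂ (fun s => exp (F s)) {s : ℂ | 1 / 2 < s.re} ∧
      (∀ s : ℂ, 1 < s.re → exp (F s) = eulerProduct α s) ∧
      (∀ s : ℂ, 1 / 2 < s.re → exp (F s) ≠ 0) ∧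
      ((fun σ : ℝ => exp (F σ)) ~[𝓝[>] (1 / 2 : ℝ)] fun σ : ℝ =>
        exp C' * exp (r * (Real.eulerMascheroniConstant : ℂ)) * ((σ - 1 / 2 : ℝ) : ℂ) ^ r) ∧
      (∀ s : ℂ, 1 / 2 < s.re →
        Tendsto (fun x : ℝ => partialProduct α s x) atTop (𝓝 (exp (F s)))) := by
  refine ⟨hFd.cexp, ?_, fun s _ => exp_ne_zero _, ?_, ?_⟩
  · -- Euler product on `Re s > 1`
    intro s hs
    have hlim : Tendsto (fun x : ℝ => partialProduct α s x) atTop (𝓝 (exp (F s))) := by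
      refine ((continuous_exp.tendsto _).comp (hpt s (by linarith))).congr fun x => ?_
      exact exp_logPartialProduct hα (by linarith) x
    exact (tendsto_partialProduct_iff_eq_eulerProduct hα hs).mp hlim
  · -- (5.2)
    have hne : ∀ᶠ σ : ℝ in 𝓝[>] (1 / 2 : ℝ),
        exp C' * exp (r * (Real.eulerMascheroniConstant : ℂ)) * ((σ - 1 / 2 : ℝ) : ℂ) ^ r ≠ 0 := by
      filter_upwards [self_mem_nhdsWithin] with σ hσ
      have hu : 0 < σ - 1 / 2 := by linarith [Set.mem_Ioi.mp hσ]
      rw [ofReal_cpow_eq_exp hu]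
      exact mul_ne_zero (mul_ne_zero (exp_ne_zero _) (exp_ne_zero _)) (exp_ne_zero _)
    refine (Asymptotics.isEquivalent_iff_tendsto_one hne).mpr ?_
    -- along `u = σ - 1/2 → 0⁺`
    have hshift : Tendsto (fun σ : ℝ => σ - 1 / 2) (𝓝[>] (1 / 2 : ℝ)) (𝓝[>] 0) := by
      refine tendsto_nhdsWithin_of_tendsto_nhds_of_eventually_within _ ?_ ?_
      · have := ((continuous_sub_right (1 / 2 : ℝ)).tendsto (1 / 2 : ℝ))
        simp only [sub_self] at this
        exact this.mono_left nhdsWithin_le_nhds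
      · filter_upwards [self_mem_nhdsWithin] with σ hσ
        exact Set.mem_Ioi.mpr (by linarith [Set.mem_Ioi.mp hσ])
    have key : Tendsto (fun u : ℝ => exp (F (1 / 2 + u) - r * Real.log u -
        (C' + r * (Real.eulerMascheroniConstant : ℂ)))) (𝓝[>] 0) (𝓝 1) := by
      have := (continuous_exp.tendsto _).comp (hbd.sub_const (C' + r * (Real.eulerMascheroniConstant : ℂ)))
      rwa [sub_self, Function.comp_def, exp_zero] at this
    refine (key.comp hshift).congr' ?_
    filter_upwards [self_mem_nhdsWithin] with σ hσ
    have hu : 0 < σ - 1 / 2 := by linarith [Set.mem_Ioi.mp hσ]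
    simp only [Function.comp_apply, Pi.div_apply]
    rw [ofReal_cpow_eq_exp hu, ← exp_add, ← exp_add, ← exp_sub]
    congr 1
    push_cast
    ring
  · intro s hs
    refine ((continuous_exp.tendsto _).comp (hpt s hs)).congr fun x => ?_
    exact exp_logPartialProduct hα (by linarith) x

/-- **Conrad 2005, Theorem 5.3 — holomorphic nonvanishing extension and the asymptotic (5.2).**
Let `α` be normalized of degree `≤ d` and suppose (5.1):
`∑_{p^k ≤ x} (∑_j α_{p,j}^k)/(k p^{k/2}) = -r log log x + C' + o(1)`. Then there is `G`, complex
differentiable on `Re s > 1/2`, equal to the Euler product `L(s)` on `Re s > 1`, without zeros on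
`Re s > 1/2`, with `G(σ) ∼ e^{C'} e^{rγ} (σ - 1/2)^r` as `σ → 1/2⁺`, and to which the partial Euler
products converge on `Re s > 1/2`. [cite: Conrad2005PartialEuler, Thm. 5.3] -/
theorem Conrad2005_thm_5_3_main {d : ℕ} {α : ℕ → Fin d → ℂ} (hα : IsNormalized α) {r C' : ℂ}
    (hH : Tendsto (fun x : ℝ => logPartialSum α (1 / 2) x -
      (-r * log ((Real.log x : ℝ) : ℂ) + C')) atTop (𝓝 0)) :
    ∃ G : ℂ → ℂ, DifferentiableOn ℂ G {s : ℂ | 1 / 2 < s.re} ∧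
      (∀ s : ℂ, 1 < s.re → G s = eulerProduct α s) ∧
      (∀ s : ℂ, 1 / 2 < s.re → G s ≠ 0) ∧
      ((fun σ : ℝ => G σ) ~[𝓝[>] (1 / 2 : ℝ)] fun σ : ℝ =>
        exp C' * exp (r * (Real.eulerMascheroniConstant : ℂ)) * ((σ - 1 / 2 : ℝ) : ℂ) ^ r) ∧
      (∀ s : ℂ, 1 / 2 < s.re → Tendsto (fun x : ℝ => partialProduct α s x) atTop (𝓝 (G s))) := by
  obtain ⟨F, hFd, -, hpt, hbd⟩ := exists_logLimit_of_single_sum hα hH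
  exact ⟨fun s => exp (F s), thm_5_3_of_logLimit hα hFd hpt hbd⟩

/-- **Conrad 2005, Theorem 5.3 (as printed), discharged:** under (5.1), `L(s)` extends to a
holomorphic nonvanishing function `G` on `Re s > 1/2` with `G(σ) ∼ e^{C'} e^{rγ} (σ - 1/2)^r`
(`σ → 1/2⁺`), and if `H` is holomorphic at `1/2` and agrees with `G` immediately to the right of
`1/2`, then the order of vanishing of `H` at `1/2` is a natural number `m = r` with
`H^{(m)}(1/2)/m! = e^{C'} e^{rγ}`. [cite: Conrad2005PartialEuler, Thm. 5.3] -/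
theorem Conrad2005_thm_5_3_holds : Conrad2005_thm_5_3 := by
  intro d α hα r C' hH
  obtain ⟨F, hFd, -, hpt, hbd⟩ := exists_logLimit_of_single_sum hα hH
  obtain ⟨h1, h2, h3, h4, -⟩ := thm_5_3_of_logLimit hα hFd hpt hbd
  refine ⟨fun s => exp (F s), h1, h2, h3, h4, fun H hHa hHG => ?_⟩
  obtain ⟨m, hmr, hord, hcoef⟩ := order_eq_of_analyticAt_of_eventuallyEq_exp hbd hHa hHG
  exact ⟨m, hmr, hord, by rw [hcoef, exp_add]⟩

end PartialEuler

end Literature.NumberTheory.LFunctions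

end
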